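import Summits.AtomisticToContinuum.BoseEinsteinCondensation.Theorems.BoxLatticeFSumSuperBlockOccupation
import Summits.AtomisticToContinuum.BoseEinsteinCondensation.Theorems.BoxLatticeFSumDCTParsevalDirichlet
import Summits.AtomisticToContinuum.BoseEinsteinCondensation.Theorems.BlockLatticeFSumShellModeCounting
import HarnessLib

/-!
# MC = `BoxShellModeCounting` PROVED (support piece of the `BoxLatticeFSum` carving of 27506)
# (decomp-a2c · hand-1 g9)

`BoxShellModeCounting : BoxShellBound → BoxDeepInfraredEmptiness → BoxMixedFloor → FlatModeDominancePos`
(lens-6 g29 node `…Theorems.BoxLatticeFSumCarving`): DCT Parseval on the block span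
(`parseval_boxBlockWaves_trialState`), the super-block domination
`Σ_B n(u_B) ≥ Σ_m n(u^{2ℓ}_m) = Σ_m n(pieceMode 0 m)` (`sum_cellOccupation_superBlock_le`, mixed floor MF at
shift `0` with `η = 1/8`), the shell budget SB at `η = θ/48` and the deep bound DE, combined by the tree's
abstract Chebyshev counting `SMC.counting_abstract`, give `n(g_0) = n(constantMode L) ≥ (5/8)N` on Dirichlet
near-minimisers, eventually in `N`, for `ρ` below the three density caps; an even `K` in the GP window
exists once `L√ρ ≥ 2A` (`exists_even_inWindow`).  Dirichlet states have `occupation = cellOccupation` for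
every one-body mode (`occupation_trialState_eq_cellOccupation`).  No definitions, no `sorry`. [folklore]
-/

noncomputable section

open MeasureTheory Filter Finset
open scoped BigOperators ENNReal Topology

namespace Summit.AtomisticToContinuum.BoseEinsteinCondensation.Theorems.BoxLatticeFSum

open Literature.MathematicalPhysics.QuantumManyBody.BoseGas
open Summit.AtomisticToContinuum.BoseEinsteinCondensation.Theses.BlockLatticeFSum
open Summit.AtomisticToContinuum.BoseEinsteinCondensation.Theorems.BlockLatticeFSumDirichletFloor

/-- For a Dirichlet trial state, `occupation = cellOccupation` for EVERY one-body mode: the slice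
`x ↦ Ψ(x, Y)` vanishes off the open box `⊆ [0,L)³`. [folklore] -/
theorem occupation_trialState_eq_cellOccupation {N : ℕ} {L : ℝ} (Ψ : TrialState N L) (φ : Space → ℂ) :
    occupation N φ Ψ.ψ = cellOccupation N L φ Ψ.ψ := by
  rw [cellOccupation, indicator_cellN_trialState Ψ le_rfl]
  cases N with
  | zero => rfl
  | succ n =>
    -- the slices agree pointwise: `Ψ(x, Y) = 0` unless `x ∈ box L ⊆ cell L`
    have hpt : ∀ (Y : Config n) (x : Space),
        (starRingEnd ℂ) (φ x) * Ψ.ψ (Matrix.vecCons x Y) =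
          (starRingEnd ℂ) ((cell L).indicator φ x) * Ψ.ψ (Matrix.vecCons x Y) := by
      intro Y x
      by_cases hx : x ∈ cell L
      · rw [Set.indicator_of_mem hx]
      · have hX : Matrix.vecCons x Y ∉ boxN (n + 1) L := by
          intro h
          have h0 := h 0
          simp only [Matrix.cons_val_zero] at h0
          exact hx fun k => Set.Ioo_subset_Ico_self (h0 k)
        rw [Set.indicator_of_notMem hx, Ψ.eq_zero _ hX, mul_zero, mul_zero]
    have hfun : ∀ Y : Config n, (fun x : Space => (starRingEnd ℂ) (φ x) * Ψ.ψ (Matrix.vecCons x Y)) =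
        fun x : Space => (starRingEnd ℂ) ((cell L).indicator φ x) * Ψ.ψ (Matrix.vecCons x Y) :=
      fun Y => funext (hpt Y)
    simp only [occupation, hfun]

/-- **MC = `BoxShellModeCounting` holds.** [folklore] -/
theorem boxShellModeCounting_holds : BoxShellModeCounting := by
  intro hSB hDE hMF v hv ha
  obtain ⟨A, hA, θ, hθ, ρD, hρD, HDE⟩ := hDE v hv ha
  obtain ⟨ρS, hρS, HSB⟩ := hSB v hv A hA (θ / 48) (by positivity)
  obtain ⟨ρM, hρM, HMF⟩ := hMF v hv A hA (1 / 8) (by norm_num)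
  refine ⟨min ρD (min ρS ρM), lt_min hρD (lt_min hρS hρM), fun ρ hρ hρlt => ?_⟩
  have hρ1 : ρ < ρD := lt_of_lt_of_le hρlt (min_le_left _ _)
  have hρ2 : ρ < ρS := lt_of_lt_of_le hρlt ((min_le_right _ _).trans (min_le_left _ _))
  have hρ3 : ρ < ρM := lt_of_lt_of_le hρlt ((min_le_right _ _).trans (min_le_right _ _))
  refine ⟨5 / 8, by norm_num, ?_⟩
  have hsρ : 0 < Real.sqrt ρ := Real.sqrt_pos.2 hρ
  have hN2 : ∀ᶠ N : ℕ in atTop, ρ * (2 * A / Real.sqrt ρ) ^ 3 ≤ (N : ℝ) :=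
    tendsto_natCast_atTop_atTop.eventually_ge_atTop _
  filter_upwards [HDE ρ hρ hρ1, HSB ρ hρ hρ2, HMF ρ hρ hρ3, hN2, eventually_ge_atTop 1]
    with N hN1 hNS hNM hNbig hNone
  obtain ⟨δ₁, hδ₁, hΨ₁⟩ := hN1
  obtain ⟨δ₂, hδ₂, hΨ₂⟩ := hNS
  obtain ⟨δ₃, hδ₃, hΨ₃⟩ := hNM
  have hNpos : 0 < N := hNone
  obtain ⟨n, rfl⟩ : ∃ n, N = n + 1 := ⟨N - 1, by omega⟩
  have hNr : (0 : ℝ) < ((n + 1 : ℕ) : ℝ) := by exact_mod_cast hNpos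
  set L : ℝ := sideLength ρ (n + 1) with hLdef
  have hL : 0 < L := Real.rpow_pos_of_pos (div_pos hNr hρ) _
  have hL3 : L ^ 3 = (((n + 1 : ℕ) : ℝ)) / ρ := sideLength_pow_three hρ (n + 1)
  refine ⟨min δ₁ (min δ₂ δ₃), lt_min hδ₁ (lt_min hδ₂ hδ₃), fun Ψ hE => ?_⟩
  have hE1 : energy v Ψ ≤ groundStateEnergy v (n + 1) L + δ₁ := hE.trans (add_le_add le_rfl (min_le_left _ _))
  have hE2 : energy v Ψ ≤ groundStateEnergy v (n + 1) L + δ₂ :=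
    hE.trans (add_le_add le_rfl ((min_le_right _ _).trans (min_le_left _ _)))
  have hE3 : energy v Ψ ≤ groundStateEnergy v (n + 1) L + δ₃ :=
    hE.trans (add_le_add le_rfl ((min_le_right _ _).trans (min_le_right _ _)))
  -- the side is long enough: `L√ρ ≥ 2A`
  have hLbig : 2 * A ≤ L * Real.sqrt ρ := by
    have hY : 0 < 2 * A / Real.sqrt ρ := by positivity
    have hLY : 2 * A / Real.sqrt ρ ≤ L := by
      by_contra hcon
      have hlt : L < 2 * A / Real.sqrt ρ := not_le.1 hcon
      have h3 : L ^ 3 < (2 * A / Real.sqrt ρ) ^ 3 := pow_lt_pow_left₀ hlt hL.le three_ne_zero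
      have : (((n + 1 : ℕ) : ℝ)) < ρ * (2 * A / Real.sqrt ρ) ^ 3 := by
        rw [hL3] at h3
        rwa [div_lt_iff₀ hρ, mul_comm] at h3
      linarith
    have := (div_le_iff₀ hsρ).1 hLY
    linarith
  -- an even `K` in the window
  obtain ⟨K, hKeven, hKpos, hwin⟩ := exists_even_inWindow hA hρ hLbig
  have hKr : (0 : ℝ) < K := by exact_mod_cast hKpos
  -- the three inputs at this `K`
  have hD := hΨ₁ Ψ hE1 K hKeven hKpos hwin
  have hS := hΨ₂ Ψ hE2 K hKeven hKpos hwin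
  have hM := hΨ₃ Ψ hE3 K hKeven hKpos hwin (fun _ => (⟨0, two_pos⟩ : Fin 2))
  -- (i) Parseval and (ii) super-block domination, in `occupation` currency
  have hPar := parseval_boxBlockWaves_trialState hNpos hKpos hL Ψ
  have hMF' : ENNReal.ofReal ((1 - 1 / 8) * ((n + 1 : ℕ) : ℝ)) ≤
      ∑ q : SubIdx K, occupation (n + 1) (boxBlockWave L K q) Ψ.ψ := by
    rw [hPar]
    refine hM.trans ?_
    simp_rw [pieceMode_zero_shift, occupation_trialState_eq_cellOccupation Ψ]
    exact sum_cellOccupation_superBlock_le hKpos hL Ψ.contDiff.continuous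
  -- counting
  classical
  have hcount := SMC.counting_abstract
    (fun q : SubIdx K => occupation (n + 1) (boxBlockWave L K q) Ψ.ψ)
    (fun q : SubIdx K => pathDispersion K q)
    (fun _ => (⟨0, hKpos⟩ : Fin K))
    ((Finset.univ : Finset (SubIdx K)).filter fun q => 0 < pathDispersion K q ∧ pathDispersion K q < θ)
    hθ hNr.le (fun q => ?_) hMF' hS hD
  · rw [occupation_boxBlockWave_of_coords_zero hKpos hL (q := fun _ => (⟨0, hKpos⟩ : Fin K))
      (fun _ => rfl)] at hcount
    exact hcount
  · rw [Finset.mem_filter, pathDispersion_pos_iff hKpos q]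
    simp

end Summit.AtomisticToContinuum.BoseEinsteinCondensation.Theorems.BoxLatticeFSum

end
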